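/-
Origin: expansion seat `prover-pub-hodgecm-mc-binder-1-g15-0`, handover #R101 2026-08-20T19:10:37Z md5 06a4579064fc (125 l.; NEW additive MODEL leaf on the (iib-R) 4-ary Model/Universe; imports #R91 Model/HeckeOperatorModel (PKG) + #R100 only; drop-alone below #R100; NAME LIST: HodgeCM.Model.heckeOpModel_eq · HodgeCM.Model.isHeckeAdmissible_model · HodgeCM.Model.heckeOpModel_mem_hodge_F_one · HodgeCM.Model.classLift_heckeOpC_model) (`HOME/mc/pub-hodgecm-mc-binder-1-g15/stage60/HodgeCM/Model/HeckeClassLiftModel.lean`, md5 06a4579064fc, 125 lines);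
landed by the second packager p2 gen 12 (p2-g12) in gate run 60 as `HodgeCM/Model/HeckeClassLiftModel.lean` (verbatim).
-/
/-
Copyright (c) 2026 the pub-hodgecm formalisation cell (harness21).  New file, not vendored.
Origin: session prover-pub-hodgecm-mc-binder-1-g15-0 (unit pub-hodgecm-mc-binder-1-g15, BINDER PROVER gen 15 of lineage mc-binder-1;
content lane (J-Liu-Θ), scope memo `HOME/mc/pub-hodgecm-mc-binder-1-g14/JLIU-THETA-SCOPE.md` §9 (J2) / §6.2 (J1), HECKE-TOWER sub-leaf (T7):
«(J1)(b) and (J2) AT THE MODEL's surface `P_Γ = U.pms L ι₁ V Γ`»), 2026-08-20.  Intended final place: `HodgeCM/Model/HeckeClassLiftModel.lean`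
(NEW additive MODEL leaf on the installed (iib-R) 4-ary `Model/Universe`; imports ONLY #R91 `HodgeCM.Model.HeckeOperatorModel` and this lane's
`HodgeCM.Model.HeckeClassLiftRecords`; nothing imports it; drop alone).
-/
import Summits.HodgeConjecture.HodgeCM.Model.HeckeOperatorModel
import Summits.HodgeConjecture.HodgeCM.Model.HeckeClassLiftRecords

set_option autoImplicit false

/-!
# (J1)(b) + (J2) at the model universe: `heckeOpModel` is admissible-everywhere, preserves `F¹`, and is intertwined by the class lift

For the model universe `universeOf hHD hI hU h₃` (`Model/Universe`, (iib-R) bytes) and its surface `P_Γ = pms L ι₁ V Γ` in the anisotropic regime `hA`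
(datum `ballDatumOf … L ι₁ V Γ hA`, upgraded by #R90 `quotientDatumOf · h₂`), and the Hecke operator `heckeOpModel h₂ L ι₁ V Γ hA k g` of #R91 on
`U.CohC (P_Γ) k`:

* `isHeckeAdmissible_model` — EVERY `g ∈ U(V)(E)` is admissible (so `heckeOpModel … g` is the genuine `T_g`, never the junk `0`): #R99 over the universe's own
  section hypothesis `hU` = (ii-a) — no new record, no Summits-side import;
* `heckeOpModel_mem_hodge_F_one` — `T_g` maps `F¹ (U.hodge (P_Γ) 1)` into itself (#R100, over `hU`, Arapura `hA'`, `hHD`, `hI`);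
* `classLift_heckeOpModel` — **(J2) at the model**: for `ω ∈ F¹H¹(P_Γ)`,
  `(ballDatumOf …).classLift hHD 𝔣 (heckeOpModel h₂ L ι₁ V Γ hA 1 g ω) = [Γ ∩ g⁻¹Γg : N_g]⁻¹ • Σ_{q ∈ Γ/N_g} h_q^* ((ballDatumOf …).classLift hHD 𝔣 ω)`,
  `h_q = frameIso 𝔣 ((g γ̃_q)^{τ₁})` — the holomorphic lift that DEFINES the model's class-map datum (`Model/ClassMapInstance.classMapDatumOf`:
  `pull = toGroup ∘ classLift`) intertwines `T_g` with the classical Hecke operator on holomorphic one-forms on the ball.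

All three by ONE-LINE specialisation of the datum-generic #R99/#R100 at `D := quotientDatumOf (ballDatumOf … hA) h₂` (whose uniformisation datum is
`ballDatumOf …` by `rfl`).  Hypotheses: the universe's `hHD hI hU h₃`, (ii-b) `h₂` (FIRM vendored print fact, path (c2)), Arapura `hA'` (the record already
behind `coverOf`) — nothing cited anew, nothing minted; 0 proof holes; expected `#print axioms` ⊆ {propext, Classical.choice, Quot.sound}.
-/

noncomputable section

open Matrix MulAction Function Set
open scoped TensorProduct
open Literature.AlgebraicGeometry.HodgeTheory
open Literature.AlgebraicGeometry.ShimuraVarieties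
open Literature.NumberTheory.Automorphic.PicardCM
open Literature.NumberTheory.Transcendental (Arapura2012_Cor_15_4_6)

namespace HodgeCM
namespace Model

open HodgeCM.Model.HeckeAdmissible HodgeCM.Model.HeckeClassLift HodgeCM.Model.HeckeClassLiftRecords

variable {hHD : exists_isReal_hodgeModel} {hI : hodgePQ_independent_of_hodgeModel}
  {hU : BallQuotientUniformisedDatum} {h₃ : CMAbelianVarietyRealised}

/-- **The ball-QUOTIENT datum of the model's surface `P_Γ`** (anisotropic regime), granted (ii-b): #R90 `quotientDatumOf` on `ballDatumOf`.  Its uniformisation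
datum is `ballDatumOf …` (`rfl`), so its `classLift`, `frameIso`, `Γ`, `E`, `H` are those of the model. [folklore] -/
abbrev modelQuotientDatum (h₂ : SpecialCyclesAlgebraic) (L : CMField) (ι₁ : L →+* ℂ) (V : HermSpace3 L ι₁) (Γ : Level V)
    (hA : IsAnisotropic L V.Hm) :
    UnitaryBallQuotientDatum 2 (Var.scheme hU h₃ ((universeOf hHD hI hU h₃).pms L ι₁ V Γ)) :=
  quotientDatumOf (ballDatumOf (hHD := hHD) (hI := hI) (hU := hU) (h₃ := h₃) L ι₁ V Γ hA) h₂

/-- Forgetting the special cycles: the model quotient datum sits over `ballDatumOf …` (definitional). [folklore] -/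
theorem modelQuotientDatum_toUnitaryBallUniformisationDatum (h₂ : SpecialCyclesAlgebraic) (L : CMField) (ι₁ : L →+* ℂ)
    (V : HermSpace3 L ι₁) (Γ : Level V) (hA : IsAnisotropic L V.Hm) :
    (modelQuotientDatum (hHD := hHD) (hI := hI) (hU := hU) (h₃ := h₃) h₂ L ι₁ V Γ hA).toUnitaryBallUniformisationDatum =
      ballDatumOf (hHD := hHD) (hI := hI) (hU := hU) (h₃ := h₃) L ι₁ V Γ hA := rfl

/-- #R91's `heckeOpModel` IS `heckeOpC` of the model quotient datum (definitional). [folklore] -/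
theorem heckeOpModel_eq (h₂ : SpecialCyclesAlgebraic) (L : CMField) (ι₁ : L →+* ℂ) (V : HermSpace3 L ι₁) (Γ : Level V)
    (hA : IsAnisotropic L V.Hm) (k : ℕ)
    (g : GL (Fin 3) ↥(ballDatumOf (hHD := hHD) (hI := hI) (hU := hU) (h₃ := h₃) L ι₁ V Γ hA).E) :
    heckeOpModel (hHD := hHD) (hI := hI) (hU := hU) (h₃ := h₃) h₂ L ι₁ V Γ hA k g =
      heckeOpC (modelQuotientDatum (hHD := hHD) (hI := hI) (hU := hU) (h₃ := h₃) h₂ L ι₁ V Γ hA)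
        (ballDatumOf (hHD := hHD) (hI := hI) (hU := hU) (h₃ := h₃) L ι₁ V Γ hA).isSmoothProjective k g := rfl

/-- **(J1)(b) at the model: every `g ∈ U(V)(E)` is admissible** for the Hecke correspondence of the END STATE's surface `P_Γ` (over the universe's own
(ii-a) `hU`). [cite: Shimura1973, §3.1 and §7.2] -/
theorem isHeckeAdmissible_model (h₂ : SpecialCyclesAlgebraic) (L : CMField) (ι₁ : L →+* ℂ) (V : HermSpace3 L ι₁) (Γ : Level V)
    (hA : IsAnisotropic L V.Hm)
    {g : GL (Fin 3) ↥(ballDatumOf (hHD := hHD) (hI := hI) (hU := hU) (h₃ := h₃) L ι₁ V Γ hA).E}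
    (hg : g ∈ unitaryGroup (conjRingHom _) (ballDatumOf (hHD := hHD) (hI := hI) (hU := hU) (h₃ := h₃) L ι₁ V Γ hA).H) :
    (modelQuotientDatum (hHD := hHD) (hI := hI) (hU := hU) (h₃ := h₃) h₂ L ι₁ V Γ hA).IsHeckeAdmissible g :=
  isHeckeAdmissible _ hU hg

/-- **`heckeOpModel` preserves `F¹H¹(P_Γ)`.** [cite: Shimura1973, §8.3] [cite: VoisinHodgeI2002, §7.3.2] -/
theorem heckeOpModel_mem_hodge_F_one (hA' : Arapura2012_Cor_15_4_6) (h₂ : SpecialCyclesAlgebraic) (L : CMField) (ι₁ : L →+* ℂ)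
    (V : HermSpace3 L ι₁) (Γ : Level V) (hA : IsAnisotropic L V.Hm)
    {g : GL (Fin 3) ↥(ballDatumOf (hHD := hHD) (hI := hI) (hU := hU) (h₃ := h₃) L ι₁ V Γ hA).E}
    (hg : g ∈ unitaryGroup (conjRingHom _) (ballDatumOf (hHD := hHD) (hI := hI) (hU := hU) (h₃ := h₃) L ι₁ V Γ hA).H)
    {ω : (universeOf hHD hI hU h₃).CohC ((universeOf hHD hI hU h₃).pms L ι₁ V Γ) 1}
    (hω : ω ∈ ((universeOf hHD hI hU h₃).hodge ((universeOf hHD hI hU h₃).pms L ι₁ V Γ) 1).F 1) :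
    heckeOpModel (hHD := hHD) (hI := hI) (hU := hU) (h₃ := h₃) h₂ L ι₁ V Γ hA 1 g ω ∈
      ((universeOf hHD hI hU h₃).hodge ((universeOf hHD hI hU h₃).pms L ι₁ V Γ) 1).F 1 :=
  HeckeClassLiftRecords.heckeOpC_mem_hodge_F_one
    (modelQuotientDatum (hHD := hHD) (hI := hI) (hU := hU) (h₃ := h₃) h₂ L ι₁ V Γ hA) hU hA' hHD hI hg
    (Var.isSmoothProjective hU h₃ ((universeOf hHD hI hU h₃).pms L ι₁ V Γ)) hω

/-- **(J2) at the model**: the holomorphic lift of the model quotient datum (= that of `ballDatumOf … Γ`, the `pull` of `classMapDatumOf`) intertwines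
`T_g = heckeOpC (modelQuotientDatum …) _ 1 g` (= `heckeOpModel … 1 g`, `heckeOpModel_eq`) on `F¹H¹(P_Γ)` with the sum of translates
`[Γ ∩ g⁻¹Γg : N_g]⁻¹ Σ_q (g γ̃_q)^*` on holomorphic one-forms on the ball — #R100 at the model, verbatim. [cite: Shimura1973, §8.3] [cite: Borel1997, §5.13–5.14] -/
theorem classLift_heckeOpC_model (hA' : Arapura2012_Cor_15_4_6) (h₂ : SpecialCyclesAlgebraic) (L : CMField) (ι₁ : L →+* ℂ)
    (V : HermSpace3 L ι₁) (Γ : Level V) (hA : IsAnisotropic L V.Hm)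
    (𝔣 : (modelQuotientDatum (hHD := hHD) (hI := hI) (hU := hU) (h₃ := h₃) h₂ L ι₁ V Γ hA).SylvesterFrame)
    {g : GL (Fin 3) ↥(modelQuotientDatum (hHD := hHD) (hI := hI) (hU := hU) (h₃ := h₃) h₂ L ι₁ V Γ hA).E}
    (hg : g ∈ unitaryGroup (conjRingHom _) (modelQuotientDatum (hHD := hHD) (hI := hI) (hU := hU) (h₃ := h₃) h₂ L ι₁ V Γ hA).H)
    {ω : (universeOf hHD hI hU h₃).CohC ((universeOf hHD hI hU h₃).pms L ι₁ V Γ) 1}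
    (hω : ω ∈ (BettiUniverse.hodge hHD (modelQuotientDatum (hHD := hHD) (hI := hI) (hU := hU) (h₃ := h₃) h₂ L ι₁ V Γ hA).isSmoothProjective 1).F 1) :
    letI : ((modelQuotientDatum (hHD := hHD) (hI := hI) (hU := hU) (h₃ := h₃) h₂ L ι₁ V Γ hA).heckeLevel g).FiniteIndex :=
      (isHeckeAdmissible_model h₂ L ι₁ V Γ hA hg).finiteIndex
    letI : Fintype (↥(modelQuotientDatum (hHD := hHD) (hI := hI) (hU := hU) (h₃ := h₃) h₂ L ι₁ V Γ hA).Γ ⧸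
        (modelQuotientDatum (hHD := hHD) (hI := hI) (hU := hU) (h₃ := h₃) h₂ L ι₁ V Γ hA).heckeLevel g) :=
      Subgroup.fintypeQuotientOfFiniteIndex
    (modelQuotientDatum (hHD := hHD) (hI := hI) (hU := hU) (h₃ := h₃) h₂ L ι₁ V Γ hA).classLift hHD 𝔣
        (heckeOpC (modelQuotientDatum (hHD := hHD) (hI := hI) (hU := hU) (h₃ := h₃) h₂ L ι₁ V Γ hA)
          (modelQuotientDatum (hHD := hHD) (hI := hI) (hU := hU) (h₃ := h₃) h₂ L ι₁ V Γ hA).isSmoothProjective 1 g ω) =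
      (((modelQuotientDatum (hHD := hHD) (hI := hI) (hU := hU) (h₃ := h₃) h₂ L ι₁ V Γ hA).heckeIndex g : ℂ)⁻¹) •
        ∑ q : ↥(modelQuotientDatum (hHD := hHD) (hI := hI) (hU := hU) (h₃ := h₃) h₂ L ι₁ V Γ hA).Γ ⧸
            (modelQuotientDatum (hHD := hHD) (hI := hI) (hU := hU) (h₃ := h₃) h₂ L ι₁ V Γ hA).heckeLevel g,
          BallForms.factorPullback BallForms.cotangentCocycle
          ((modelQuotientDatum (hHD := hHD) (hI := hI) (hU := hU) (h₃ := h₃) h₂ L ι₁ V Γ hA).frameIso 𝔣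
            (cosetRealPoint (isHeckeAdmissible_model h₂ L ι₁ V Γ hA hg) (Quotient.out q)))
          ((modelQuotientDatum (hHD := hHD) (hI := hI) (hU := hU) (h₃ := h₃) h₂ L ι₁ V Γ hA).classLift hHD 𝔣 ω) :=
  HeckeClassLiftRecords.classLift_heckeOpC
    (modelQuotientDatum (hHD := hHD) (hI := hI) (hU := hU) (h₃ := h₃) h₂ L ι₁ V Γ hA) hU hA' hHD hI 𝔣 hg hω

end Model
end HodgeCM

end
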